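import Summits.ResolutionOfSingularities.ResolutionOfSingularities.Theorems.EquisingularLiftEquisingularLiftNatMemberSLStepSingular
import Summits.ResolutionOfSingularities.ResolutionOfSingularities.Theorems.EquisingularLiftEquisingularLiftNatInvKCLStepSingular
import HarnessLib

/-!
# [OURS · L1 W4.5(b) · EL♮(3) · T23-A‴ (U6)] (D)SL: the driver clause (singular in-carrier step, flag spent) at `INV := TCPlus.InvSL` — the letter-list
# twin of res-type-027's `invS_step_singular` (…NatInvSStepSingular p618612; pattern of res-L1-w45b-stub-4's …NatInvKCLStepSingular), rule (D‴5′) of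
# stub-4's ENGINE WORD v1.1 f996922ad41a17f2, menu = res-L1-w45b-lead-2's `InCarrierReachKSs` 0c6a341d172f5c17

res-type-027 g18 ((U6) owner), brick (F5d). OURS; NOT a statement of any manuscript ([Hironaka2017] is a candidate under adjudication, nothing of
it is asserted); AI-written, weaker than expert review. No `sorry`; standard axioms; DEF-FREE; `--supports stmt-ResolutionOfSingularities-20148 --as helper`.

WHAT. `invSL_step_singular`: `TCPlus.InvSL … W G₁ β T Z Kd Sd Ls false` (letters closed) at a NON-regular in-carrier point `y` of the reduced curve with
`G₁` regular at `y` (NOW USED: it gives the new plane its model) ⟹ for every `Ls'` from the menu `{υ₁⁻¹{y}} ∪ {St L | L ∈ Ls, y ∉ L}`: letters closed and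
`TCPlus.InvSL … W G₂ (υ₁ ≫ β) (St T) (St Z) (St Kd) (St Sd) Ls' true`. PROOF = p618612's VERBATIM with `memberSL_strictTransform_of_centredPoint`.
[cite: GortzWedhorn2020, Prop. 13.91 and (13.19)] [cite: Liu2002, Thm. 8.1.19] [cite: Matsumura1987, Thm. 14.2] [cite: StacksProject, Tag 01WS]
-/

set_option linter.dupNamespace false -- mandated namespace `Summit.<Summit>.<Problem>` of this single-conjunct summit
set_option linter.overlappingInstances false -- signatures carry `[IsDomain O] [IsDiscreteValuationRing O]`

noncomputable section

open CategoryTheory CategoryTheory.Limits AlgebraicGeometry TopologicalSpace Topology IsLocalRing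
open Literature.AlgebraicGeometry.Resolution
open AlgebraicGeometry.Scheme.IdealSheafData
open Summit.ResolutionOfSingularities.ResolutionOfSingularities.Theses.EquisingularLift.Split

namespace Summit.ResolutionOfSingularities.ResolutionOfSingularities.Cruxes.EquisingularLiftNat.Sections

/-- **(D)SL — the driver clause (singular step, flag spent) at `INV := TCPlus.InvSL`, menu form** (see the module docstring).
[cite: Matsumura1987, Thm. 14.2 and Thm. 20.3] [cite: GortzWedhorn2020, Prop. 13.91] [cite: Liu2002, Thm. 8.1.19] [OURS · L1 W4.5b · T23-A‴ (U6)] brick (F5d)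
(stmt-ResolutionOfSingularities-20148); NOT a statement of the manuscript. -/
theorem invSL_step_singular (O : Type) [CommRing O] [IsDomain O] [IsDiscreteValuationRing O]
    (k : Type) [Field k] (θ : O →+* k) (hθ : Function.Surjective θ)
    (P : Scheme.{0}) [IsIntegral P] (q : P ⟶ Spec (.of O)) [IsProper q] [SmoothOfRelativeDimension 3 q]
    (Y : Set P) (hYsp : Y ⊆ q ⁻¹' {closedPoint O}) (hYirr : IsIrreducible Y) (hYcl : IsClosed Y)
    (hPnoeth : IsLocallyNoetherian P) (hPreg : Scheme.IsRegular P)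
    (Ch : ∀ X' : Scheme.{0}, (X' ⟶ P) → Set X' → Prop)
    (hChain : ∀ (X' : Scheme.{0}) (σ : X' ⟶ P) (S : Set X'), Ch X' σ S → Chain P Y X' σ S)
    (hStep : ∀ (X' X'' : Scheme.{0}) (σ' : X' ⟶ P) (S' : Set X') (C : X'.IdealSheafData) (τ : X'' ⟶ X'),
      Ch X' σ' S' → IsBlowup τ C → Scheme.IsRegular C.subscheme → Flat (C.subschemeι ≫ σ' ≫ q) →
      σ' '' (C.support : Set X') ⊆ {x : P | ¬ IsGenericPoint x Y} →
      (C.support : Set X') ∩ (σ' ≫ q) ⁻¹' {closedPoint O} ⊆ S' →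
      Ch X'' (τ ≫ σ') (closure (τ ⁻¹' (S' \ (C.support : Set X')))))
    {F₁ F₂ : Scheme.{0}} (W : Set F₁) (G₁ G₂ : Scheme.{0}) (β : G₁ ⟶ F₂) (T Z Kd Sd : Set G₁) (Ls : List (Set G₁))
    (y : ↥((vanishingIdeal (⟨closure Z, isClosed_closure⟩ : Closeds G₁))).subscheme) (υ₁ : G₂ ⟶ G₁)
    (hy : IsClosed ({((vanishingIdeal (⟨closure Z, isClosed_closure⟩ : Closeds G₁)).subschemeι y : G₁)} : Set G₁))
    (hInv : TCPlus.InvSL O k θ P q Y Ch W G₁ β T Z Kd Sd Ls false) (hLcl : ∀ L ∈ Ls, IsClosed L) (hZcl : IsClosed Z)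
    (hyT : ((vanishingIdeal (⟨closure Z, isClosed_closure⟩ : Closeds G₁)).subschemeι y : G₁) ∈ T)
    (hysing : ¬ IsRegularLocalRing
      (((vanishingIdeal (⟨closure Z, isClosed_closure⟩ : Closeds G₁))).subscheme.presheaf.stalk y))
    (hyreg : IsRegularLocalRing
      (G₁.presheaf.stalk ((vanishingIdeal (⟨closure Z, isClosed_closure⟩ : Closeds G₁)).subschemeι y)))
    (hυ₁ : IsBlowup υ₁ (vanishingIdeal
      ⟨{((vanishingIdeal (⟨closure Z, isClosed_closure⟩ : Closeds G₁)).subschemeι y : G₁)}, hy⟩)) :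
    ∀ Ls' : List (Set G₂), (∀ L' ∈ Ls', L' = υ₁ ⁻¹' {((vanishingIdeal (⟨closure Z, isClosed_closure⟩ : Closeds G₁)).subschemeι y : G₁)} ∨
        ∃ L ∈ Ls, ((vanishingIdeal (⟨closure Z, isClosed_closure⟩ : Closeds G₁)).subschemeι y : G₁) ∉ L ∧
          L' = closure (υ₁ ⁻¹' (L \ {((vanishingIdeal (⟨closure Z, isClosed_closure⟩ : Closeds G₁)).subschemeι y : G₁)}))) →
      (∀ L' ∈ Ls', IsClosed L') ∧
      TCPlus.InvSL O k θ P q Y Ch W G₂ (υ₁ ≫ β)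
        (closure (υ₁ ⁻¹' (T \ {((vanishingIdeal (⟨closure Z, isClosed_closure⟩ : Closeds G₁)).subschemeι y : G₁)})))
        (closure (υ₁ ⁻¹' (Z \ {((vanishingIdeal (⟨closure Z, isClosed_closure⟩ : Closeds G₁)).subschemeι y : G₁)})))
        (closure (υ₁ ⁻¹' (Kd \ {((vanishingIdeal (⟨closure Z, isClosed_closure⟩ : Closeds G₁)).subschemeι y : G₁)})))
        (closure (υ₁ ⁻¹' (Sd \ {((vanishingIdeal (⟨closure Z, isClosed_closure⟩ : Closeds G₁)).subschemeι y : G₁)}))) Ls' true := by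
  classical
  obtain ⟨hGint, -, -, hTZ, -, hflag⟩ := hInv
  haveI := hGint
  have hmem := hflag rfl y hy hysing
  have hxZ : ((vanishingIdeal (⟨closure Z, isClosed_closure⟩ : Closeds G₁)).subschemeι y : G₁) ∈ closure Z := by
    have h : ((vanishingIdeal (⟨closure Z, isClosed_closure⟩ : Closeds G₁)).subschemeι y : G₁) ∈
        Set.range (vanishingIdeal (⟨closure Z, isClosed_closure⟩ : Closeds G₁)).subschemeι := ⟨y, rfl⟩
    rw [Scheme.IdealSheafData.range_subschemeι, Scheme.IdealSheafData.coe_support_vanishingIdeal] at h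
    exact h
  have hTx : ¬ T ⊆ {((vanishingIdeal (⟨closure Z, isClosed_closure⟩ : Closeds G₁)).subschemeι y : G₁)} := fun h =>
    hTZ (h.trans (Set.singleton_subset_iff.mpr hxZ))
  obtain ⟨hG₂int, hT₂irr, hmenu⟩ := memberSL_strictTransform_of_centredPoint O k θ hθ P q Y hYsp hYirr hYcl hPnoeth hPreg Ch
    hChain hStep G₁ T Z Kd Sd _ hy hyT hTx Ls hmem hLcl hxZ hyreg hZcl G₂ υ₁ hυ₁
  intro Ls' hLs'
  obtain ⟨hLcl', hmem₂⟩ := hmenu Ls' hLs'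
  exact ⟨hLcl', hG₂int, isClosed_closure, hT₂irr, not_closure_preimage_diff_subset_of_isBlowup_point υ₁ hy hυ₁ hTZ hxZ, hmem₂,
    fun h => Bool.noConfusion h⟩

end Summit.ResolutionOfSingularities.ResolutionOfSingularities.Cruxes.EquisingularLiftNat.Sections

end
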